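import Summits.KontsevichZagierPeriods.KontsevichZagierPeriods.Theorems.RootDecompWalshStrataConicDescent

/-!
# Planar sections: Newton–Leibniz over the cells of a cylindrical decomposition, modulo the Baker sector

Gen 7 of the decomposition node `WalshStrata` (route `RootDecompWalshStrata`, support item
`QuadricBakerDescent` stmt-KontsevichZagierPeriods-27597, slice `d = 3`).  The ENGINE behind the typed
target `AffineDescent₂` (lens file §21) and every later fibred descent over a planar base: for a bounded
OPEN `ℚ`-semialgebraic `W ⊆ [0,1]^{N+1}` and a representation `[W, f]` whose integrand is the
last-coordinate derivative of a continuous `ℚ`-semialgebraic potential `Φ` (`∂Φ/∂t = f` on `W`),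
`[W, f]` lies in the Baker sector modulo KZ's rules (1)–(3) AS SOON AS every boundary section term
`[S, Φ(x, ζ x)]` does — where `S` ranges over `ℚ`-semialgebraic subsets of the base and `ζ` over
continuous `ℚ`-semialgebraic functions on `S` whose graph lies in the FRONTIER of `W`
(`InBaker.of_planar_sections`).  Mechanism: cylindrical decomposition of the base adapted to `W`
(`IsSemialgebraic.exists_cylindricalDecomposition_holds`); over a cell `C` of positive volume every band of
`W` is inner, rule (1) cuts `[W ∩ (C × ℝ)]` into its open bands, rule (3) (`KZ.exists_band_newtonLeibniz`)
turns each band into `[C, Φ(·, ξ_j) − Φ(·, ξ_{j-1})]`, and in the sum over the bands of `W` over `C` the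
INTERIOR sections (a section that is the top of one band of `W` and the bottom of the next) CANCEL
identically; the surviving sections are tops/bottoms of bands of `W` adjacent to the complement, i.e.
their graphs lie in `closure W ∖ W = frontier W` (`W` open).  Null cells and the graphs contribute
relations (rule (1a) with a null piece).  Also: `InBaker.sum`, the hereditary cover lemma
`InBaker.of_cover`, and null zero-sets of nonzero polynomials.  Imports the landed conic descent 7/7
(hence `KZGroundingRelations`, `CylindricalDecompositionProofs`).
[KontsevichZagier2001 §1.2 rules (1),(3); BasuPollackRoy2006 Cor. 5.7; BCR1998 §2.2]

This is part 1/2 (§25.1–25.2: finite sums, hereditary covers, null zero sets, section helpers); the engine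
`InBaker.of_cadCell` / `InBaker.of_planar_sections` is part 2/2 (`RootDecompWalshStrataPlanarSections02`).
-/

noncomputable section

open Literature.NumberTheory.Transcendental
open MeasureTheory Set
open MvPolynomial (aeval X C)
open Literature.ModelTheory.ExponentialFields (IsSemialgebraic isSemialgebraic_univ
  isSemialgebraic_setOf_eval_pos isSemialgebraic_setOf_eval_lt isSemialgebraic_setOf_eval_le
  isSemialgebraic_setOf_eval_nonneg isSemialgebraic_setOf_eval_eq_zero continuous_aeval_real
  tarski_seidenberg_real_holds graphOver bandOver bandLower bandUpper mem_bandOver_iff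
  snoc_mem_bandOver_iff snoc_mem_bandOver_iff_of_ne bandLower_of_ne_zero bandUpper_of_ne_last
  bandLower_succ bandUpper_castSucc bandLower_zero bandUpper_last)
open Literature.ModelTheory.ExponentialFields.CylindricalDecomposition (mem_band_iff band_eq_band
  not_mem_band_of_eq exists_mem_band)

namespace Summit.KontsevichZagierPeriods.RootDecompWalshStrata.ConicDescent

/-! #### 25.1 Finite sums, hereditary covers, null zero sets -/

/-- `InBaker` is closed under finite sums. [this node] -/
theorem InBaker.sum {ι : Type*} (s : Finset ι) (c : ι → KZ.FormalRep)
    (h : ∀ i ∈ s, InBaker (c i)) : InBaker (∑ i ∈ s, c i) :=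
  Finset.sum_induction c InBaker (fun _ _ ha hb => ha.add hb) InBaker.zero h

/-- HEREDITARY COVER LEMMA (rule (1a) iterated): if the domain of `r` is covered by finitely many
`ℚ`-semialgebraic sets `A i` and EVERY restriction of `r` to a `ℚ`-semialgebraic subset of some `A i`
lands in the Baker sector, then so does `[r]` (peel `A 0`, recurse on the rest). [this node] -/
theorem InBaker.of_cover {N : ℕ} :
    ∀ {k : ℕ} (r : KZ.IntegralRep N) (A : Fin k → Set (Fin N → ℝ)),
      (∀ i, IsSemialgebraic ℚ (A i)) → (r.domain ⊆ ⋃ i, A i) →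
      (∀ i (T : Set (Fin N → ℝ)) (hT : IsSemialgebraic ℚ T) (hTr : T ⊆ r.domain), T ⊆ A i →
        InBaker (KZ.of (r.restrict T hT hTr))) → InBaker (KZ.of r) := by
  intro k
  induction k with
  | zero =>
    intro r A _ hcov _
    have h0 : r.domain = ∅ := eq_empty_of_subset_empty (by simpa [iUnion_of_empty] using hcov)
    exact InBaker.of_mem_relations
      (KZ.of_mem_relations_of_volume_eq_zero r (by rw [h0, measure_empty]))
  | succ k ih =>
    intro r A hA hcov h
    have hT₀ : IsSemialgebraic ℚ (r.domain ∩ A 0) := r.isSemialgebraic_domain.inter (hA 0)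
    have hT₁ : IsSemialgebraic ℚ (r.domain \ A 0) := r.isSemialgebraic_domain.diff (hA 0)
    refine InBaker.of_split r hT₀ hT₁ inter_subset_left sdiff_subset
      (by rw [inter_union_sdiff]) ?_ (h 0 _ hT₀ inter_subset_left inter_subset_right) ?_
    · rw [show (r.domain ∩ A 0) ∩ (r.domain \ A 0) = ∅ from
        eq_empty_of_forall_notMem fun x hx => hx.2.2 hx.1.2, measure_empty]
    · refine ih (r.restrict (r.domain \ A 0) hT₁ sdiff_subset) (fun i => A i.succ)
        (fun i => hA i.succ) (fun x hx => ?_) fun i T hT hTr hTA => ?_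
      · obtain ⟨hxr, hx0⟩ : x ∈ r.domain ∧ x ∉ A 0 := hx
        obtain ⟨i, hi⟩ := mem_iUnion.1 (hcov hxr)
        refine mem_iUnion.2 ?_
        rcases Fin.eq_zero_or_eq_succ i with rfl | ⟨j, rfl⟩
        · exact absurd hi hx0
        · exact ⟨j, hi⟩
      · have hTr' : T ⊆ r.domain := fun x hx => (hTr hx).1
        exact h i.succ T hT hTr' hTA

/-- `InBaker.of_cover` for a cover indexed by an arbitrary finite type. [this node] -/
theorem InBaker.of_cover' {N : ℕ} {ι : Type*} [Fintype ι] (r : KZ.IntegralRep N)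
    (A : ι → Set (Fin N → ℝ)) (hA : ∀ i, IsSemialgebraic ℚ (A i)) (hcov : r.domain ⊆ ⋃ i, A i)
    (h : ∀ i (T : Set (Fin N → ℝ)) (hT : IsSemialgebraic ℚ T) (hTr : T ⊆ r.domain), T ⊆ A i →
      InBaker (KZ.of (r.restrict T hT hTr))) : InBaker (KZ.of r) := by
  classical
  refine InBaker.of_cover r (fun j => A ((Fintype.equivFin ι).symm j)) (fun j => hA _)
    (fun x hx => ?_) fun j T hT hTr hTA => h _ T hT hTr hTA
  obtain ⟨i, hi⟩ := mem_iUnion.1 (hcov hx)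
  exact mem_iUnion.2 ⟨Fintype.equivFin ι i, by simpa only [Equiv.symm_apply_apply] using hi⟩

/-- The zero set of a polynomial over `ℚ` that does not vanish identically on `ℝⁿ` is Lebesgue-null.
[folklore; `volume_setOf_aeval_eq_zero`] -/
theorem volume_zeroSet_eq_zero {n : ℕ} (q : MvPolynomial (Fin n) ℚ) (h : ∃ x : Fin n → ℝ, aeval x q ≠ 0) :
    volume {x : Fin n → ℝ | aeval x q = 0} = 0 := by
  refine volume_setOf_aeval_eq_zero q fun h0 => ?_
  obtain ⟨x, hx⟩ := h
  apply hx
  rw [MvPolynomial.aeval_def, ← MvPolynomial.eval_map, h0, map_zero]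

/-- A representation whose domain lies in the zero set of a polynomial over `ℚ` not vanishing
identically is a relation, hence in the Baker sector. [KontsevichZagier2001 §1.2 rule (1)] -/
theorem InBaker.of_subset_zeroSet {n : ℕ} (r : KZ.IntegralRep n) (q : MvPolynomial (Fin n) ℚ)
    (h : ∃ x : Fin n → ℝ, aeval x q ≠ 0) (hsub : ∀ x ∈ r.domain, aeval x q = 0) :
    InBaker (KZ.of r) :=
  InBaker.of_mem_relations (KZ.of_mem_relations_of_volume_eq_zero r
    (measure_mono_null (fun x hx => hsub x hx) (volume_zeroSet_eq_zero q h)))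

/-- A representation with empty domain is a relation, hence in the Baker sector. -/
theorem InBaker.of_domain_eq_empty {n : ℕ} (r : KZ.IntegralRep n) (h : r.domain = ∅) :
    InBaker (KZ.of r) :=
  InBaker.of_mem_relations (KZ.of_mem_relations_of_volume_eq_zero r (by rw [h, measure_empty]))

/-! #### 25.2 Sections: semialgebraic composition, fibre endpoints, adjacency -/

/-- `t ↦ (x, t)` is continuous.  (PRIVATE: a landed twin
`…ArrangementNormalForm.JanusBands.IntegrateOut.continuous_snoc` lives in a module outside this chain;
gate lint `dedup.landed` — part 2 keeps its own private copy.) -/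
private theorem continuous_snoc_right {N : ℕ} (x : Fin N → ℝ) :
    Continuous fun t : ℝ => (Fin.snoc x t : Fin (N + 1) → ℝ) :=
  continuous_pi fun i => by
    induction i using Fin.lastCases with
    | last => simp only [Fin.snoc_last]; exact continuous_id
    | cast i => simp only [Fin.snoc_castSucc]; exact continuous_const

/-- Composition of a `ℚ`-semialgebraic function on `ℝ^{N+1}` with a `ℚ`-semialgebraic section
`x ↦ (x, ζ x)` over `S` is `ℚ`-semialgebraic on `S` (Tarski–Seidenberg). [BCR1998 Prop. 2.2.6] -/
theorem isSemialgebraicFunOn_comp_snoc {N : ℕ} {S : Set (Fin N → ℝ)} (hS : IsSemialgebraic ℚ S)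
    {Φ : (Fin (N + 1) → ℝ) → ℝ} (hΦ : IsSemialgebraicFunOn ℚ univ Φ) {ζ : (Fin N → ℝ) → ℝ}
    (hζ : IsSemialgebraicFunOn ℚ S ζ) :
    IsSemialgebraicFunOn ℚ S (fun x => Φ (Fin.snoc x (ζ x) : Fin (N + 1) → ℝ)) := by
  have hmap : IsSemialgebraicMapOn ℚ S (fun x => (Fin.snoc x (ζ x) : Fin (N + 1) → ℝ)) := by
    refine IsSemialgebraicMapOn.of_forall hS fun j => ?_
    induction j using Fin.lastCases with
    | last => simpa only [Fin.snoc_last] using hζ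
    | cast i => simpa only [Fin.snoc_castSucc] using isSemialgebraicFunOn_apply hS i
  exact IsSemialgebraicFunOn.comp_isSemialgebraicMapOn_holds hΦ hmap (mapsTo_univ _ _)

/-- FIBRE ENDPOINTS: if the open vertical interval `(p, q)` over `x` (`p < q`) maps into
`W ⊆ [0,1]^{N+1}`, then `x ∈ [0,1]^N` and both endpoints `(x, p)`, `(x, q)` lie in `closure W`. -/
theorem fibre_endpoints {N : ℕ} {W : Set (Fin (N + 1) → ℝ)} (hWI : W ⊆ Icc 0 1) {x : Fin N → ℝ}
    {p q : ℝ} (hpq : p < q) (hsub : ∀ t ∈ Ioo p q, (Fin.snoc x t : Fin (N + 1) → ℝ) ∈ W) :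
    x ∈ Icc (0 : Fin N → ℝ) 1 ∧ (Fin.snoc x p : Fin (N + 1) → ℝ) ∈ closure W ∧
      (Fin.snoc x q : Fin (N + 1) → ℝ) ∈ closure W := by
  have hg := continuous_snoc_right x
  have himg : (fun t : ℝ => (Fin.snoc x t : Fin (N + 1) → ℝ)) '' Ioo p q ⊆ W := by
    rintro _ ⟨t, ht, rfl⟩; exact hsub t ht
  have hcl : (fun t : ℝ => (Fin.snoc x t : Fin (N + 1) → ℝ)) '' Icc p q ⊆ closure W := by
    rw [← closure_Ioo hpq.ne]
    exact (image_closure_subset_closure_image hg).trans (closure_mono himg)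
  have hp : (Fin.snoc x p : Fin (N + 1) → ℝ) ∈ closure W := hcl ⟨p, left_mem_Icc.2 hpq.le, rfl⟩
  have hq : (Fin.snoc x q : Fin (N + 1) → ℝ) ∈ closure W := hcl ⟨q, right_mem_Icc.2 hpq.le, rfl⟩
  have hp' : (Fin.snoc x p : Fin (N + 1) → ℝ) ∈ Icc (0 : Fin (N + 1) → ℝ) 1 :=
    closure_minimal hWI isClosed_Icc hp
  refine ⟨⟨fun i => ?_, fun i => ?_⟩, hp, hq⟩
  · have h := hp'.1 (Fin.castSucc i)
    simp only [Fin.snoc_castSucc, Pi.zero_apply] at h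
    exact h
  · have h := hp'.2 (Fin.castSucc i)
    simp only [Fin.snoc_castSucc, Pi.one_apply] at h
    exact h

/-- ADJACENCY: if over `x` the vertical fibre of the OPEN set `W` is the union of the section values
`ξ_j x`, `j ∈ G`, and of the bands `j ∈ B` (strictly increasing sections), and the section point
`(x, ξ_i x)` lies IN `W`, then both bands adjacent to `ξ_i` over `x` belong to `B`. [this node] -/
theorem adjacent_mem_of_snoc_mem {N l : ℕ} {W : Set (Fin (N + 1) → ℝ)} (hWo : IsOpen W)
    (ξ : Fin l → (Fin N → ℝ) → ℝ) {x : Fin N → ℝ} (hmono : StrictMono fun i => ξ i x)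
    (G : Finset (Fin l)) (B : Finset (Fin (l + 1)))
    (hfib : {t : ℝ | (Fin.snoc x t : Fin (N + 1) → ℝ) ∈ W} = (⋃ j ∈ G, {ξ j x}) ∪
      ⋃ j ∈ B, {t : ℝ | bandLower ξ j x < (t : EReal) ∧ (t : EReal) < bandUpper ξ j x})
    {i : Fin l} (hi : (Fin.snoc x (ξ i x) : Fin (N + 1) → ℝ) ∈ W) :
    i.succ ∈ B ∧ i.castSucc ∈ B := by
  have hU : IsOpen {t : ℝ | (Fin.snoc x t : Fin (N + 1) → ℝ) ∈ W} :=
    hWo.preimage (continuous_snoc_right x)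
  obtain ⟨lo, up, ⟨hlo, hup⟩, hsub⟩ := mem_nhds_iff_exists_Ioo_subset.1 (hU.mem_nhds hi)
  have key : ∀ (j : Fin (l + 1)) (t : ℝ), (Fin.snoc x t : Fin (N + 1) → ℝ) ∈ W →
      bandLower ξ j x < (t : EReal) ∧ (t : EReal) < bandUpper ξ j x → j ∈ B := by
    intro j t ht hj
    have ht' : t ∈ {t : ℝ | (Fin.snoc x t : Fin (N + 1) → ℝ) ∈ W} := ht
    rw [hfib] at ht'
    rcases ht' with ht' | ht'
    · simp only [mem_iUnion, mem_singleton_iff, exists_prop] at ht'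
      obtain ⟨i', -, hi'⟩ := ht'
      exact absurd hj (not_mem_band_of_eq ξ x hmono hi')
    · simp only [mem_iUnion, mem_setOf_eq, exists_prop] at ht'
      obtain ⟨j', hj', hj't⟩ := ht'
      rwa [band_eq_band ξ x hmono hj hj't]
  constructor
  · have h1 : ((ξ i x : ℝ) : EReal) < min ((up : ℝ) : EReal) (bandUpper ξ i.succ x) := by
      refine lt_min (EReal.coe_lt_coe_iff.2 hup) ?_
      by_cases hl : i.succ = Fin.last l
      · rw [hl, bandUpper_last]; exact EReal.coe_lt_top _
      · rw [bandUpper_of_ne_last ξ _ hl, EReal.coe_lt_coe_iff]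
        apply hmono
        rw [Fin.lt_def, Fin.coe_castPred, Fin.val_succ]
        exact Nat.lt_succ_self _
    obtain ⟨t, ht1, ht2⟩ := EReal.exists_between_coe_real h1
    have ht2' := lt_min_iff.1 ht2
    refine key i.succ t (hsub ⟨hlo.trans (EReal.coe_lt_coe_iff.1 ht1),
      EReal.coe_lt_coe_iff.1 ht2'.1⟩) ⟨?_, ht2'.2⟩
    rw [bandLower_succ]; exact ht1
  · have h1 : max ((lo : ℝ) : EReal) (bandLower ξ i.castSucc x) < ((ξ i x : ℝ) : EReal) := by
      refine max_lt (EReal.coe_lt_coe_iff.2 hlo) ?_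
      by_cases h0 : i.castSucc = 0
      · rw [h0, bandLower_zero]; exact EReal.bot_lt_coe _
      · rw [bandLower_of_ne_zero ξ _ h0, EReal.coe_lt_coe_iff]
        apply hmono
        rw [Fin.lt_def, Fin.val_pred, Fin.val_castSucc]
        have : (i : ℕ) ≠ 0 := fun h => h0 (Fin.ext (by simp [h]))
        omega
    obtain ⟨t, ht1, ht2⟩ := EReal.exists_between_coe_real h1
    have ht1' := max_lt_iff.1 ht1
    refine key i.castSucc t (hsub ⟨EReal.coe_lt_coe_iff.1 ht1'.1,
      (EReal.coe_lt_coe_iff.1 ht2).trans hup⟩) ⟨ht1'.2, ?_⟩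
    rw [bandUpper_castSucc]; exact ht2

end Summit.KontsevichZagierPeriods.RootDecompWalshStrata.ConicDescent
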